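import Summits.HodgeConjecture.CorCM.MumfordTateRankCMCurveTimesCMThreefold
import Summits.HodgeConjecture.CorCM.MumfordTateRankTimesCMCurveSameField
import Summits.HodgeConjecture.CorCM.MumfordTateRankTimesNonCMCurve
import HarnessLib

/-!
# The fourfold partition `{1, 3}`: the Mumford–Tate rank of `E × T` (elliptic curve × SIMPLE abelian threefold) in every cell —
# `t(E × T) + 1 = t(E) + t(T)` except exactly when `E` is of CM type and `End⁰E ↪ End⁰T`, where one more dimension is lost;
# `t(E × T) ∈ {4, 5, 7, 10, 11, 13, 23, 25}`

COR-CM (cell `pub-hodgecm2`, seat `b27` gen 49, count-neutral Mumford–Tate-rank ladder; theorems only, no definition, no named fact;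
UNCONDITIONAL — nothing here uses or asserts HC_CM).  Notation `t(X) = dim MT(H¹X)`.

Moonen–Zarhin Thm. (0.1): a complex abelian fourfold `X ∼ E × T` (`E` an elliptic curve, `T` a simple threefold) has
`Hg(X) = Hg(E) × Hg(T)` unless it is in case (a): `E` has complex multiplication by `k` and `k ↪ End⁰(T)` — then `Hg(X)` has codimension
one in `Hg(E) × Hg(T)` (the Weil classes of `X`).  Every cell is a theorem of the tree: non-CM `E` (`t(E) = 4`):
`mtRank_hodge_one_eq_add_three_of_isIsogenous_threefold_prod_nonCMCurve` (gen 47, Lemma (3.4)); CM `E` (`t(E) = 2`): `End⁰T = ℚ ↦ 23`, cubic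
`↦ 11` (`CorCM/MumfordTateRankCMCurveTimesThreefold`), imaginary quadratic `↦ 10 / 11` according as `End⁰E ↪ End⁰T` or not
(`CorCM/MumfordTateRankTimesCMCurveSameField`, gen 48), CM sextic `↦ 4 / 5` likewise (`CorCM/MumfordTateRankCMCurveTimesCMThreefold`, gen 49).

* **`mtRank_hodge_one_add_one_eq_add_or_of_isIsogenous_curve_prod_isSimple_threefold`** — for every `X ∼ E × T`: EITHER
  `t(X) + 1 = t(E) + t(T)`, OR `E` is of CM type, `End⁰E ↪ End⁰T` and `t(X) + 2 = t(E) + t(T)`.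
* **`mtRank_hodge_one_mem_of_isIsogenous_curve_prod_isSimple_threefold`** — `t(X) ∈ {4, 5, 7, 10, 11, 13, 23, 25}`.

## References
* [MoonenZarhin1999LowDim] B. Moonen, Yu. G. Zarhin, *Hodge classes on abelian varieties of low dimension*, Math. Ann. 315 (1999), Thm. (0.1),
  §2 (2.1), (2.3), §3 Lemma (3.4), Prop. (3.8), (5.4)–(5.5) [corpus: paper:arxiv-math_9901113 pp. 1, 5–7, 9–10].
  [cite: MoonenZarhin1999LowDim, Thm. (0.1) and §3 Prop. (3.8)]
* [MumfordAV1970] D. Mumford, *Abelian Varieties* (1970), §19 Cor. 2 of Thm. 1, §22. [cite: MumfordAV1970, §19 Cor. 2 of Thm. 1]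
-/

noncomputable section

open CategoryTheory CategoryTheory.Limits Module

namespace Summit.HodgeConjecture.CorCM

open Literature.AlgebraicGeometry.Motives
open Literature.AlgebraicGeometry.Motives.AbelianVariety
open Literature.AlgebraicGeometry.Motives.HodgeStructure
open Literature.AlgebraicGeometry.HodgeTheory
open Literature.AlgebraicGeometry.Milne1999 (IsOfCMType)

variable [HodgeTensorFacts.{0, 0}] {X : AbelianVariety ℂ} {n : ℕ}

/-- **`t(E × T) + 1 = t(E) + t(T)`, or `E` is CM with `End⁰E ↪ End⁰T` and `t(E × T) + 2 = t(E) + t(T)`** — for every elliptic curve `E`, every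
SIMPLE abelian threefold `T` and every `X ∼ E × T` (Moonen–Zarhin Thm. (0.1): outside case (a) the Hodge group of a curve × simple threefold is
the product; in case (a) it has codimension one). [cite: MoonenZarhin1999LowDim, Thm. (0.1) and §3 Prop. (3.8)] -/
theorem mtRank_hodge_one_add_one_eq_add_or_of_isIsogenous_curve_prod_isSimple_threefold (hX : IsSmoothProjective n X.X)
    {E T : AbelianVariety ℂ} {k l : ℕ} (hE : IsSmoothProjective k E.X) (hT : IsSmoothProjective l T.X) (hE1 : E.dim = 1) (hTs : T.IsSimple)
    (hT3 : T.dim = 3) (hXP : IsIsogenous X (E.prod T)) :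
    haveI := BettiUniverse.finite hX 1
    haveI := BettiUniverse.finite hE 1
    haveI := BettiUniverse.finite hT 1
    (BettiUniverse.hodge exists_isReal_hodgeModel_holds hX 1).mtRank + 1 =
        (BettiUniverse.hodge exists_isReal_hodgeModel_holds hE 1).mtRank + (BettiUniverse.hodge exists_isReal_hodgeModel_holds hT 1).mtRank ∨
      (IsOfCMType E ∧ Nonempty (E.endAlgebra →+* T.endAlgebra) ∧
        (BettiUniverse.hodge exists_isReal_hodgeModel_holds hX 1).mtRank + 2 =
          (BettiUniverse.hodge exists_isReal_hodgeModel_holds hE 1).mtRank + (BettiUniverse.hodge exists_isReal_hodgeModel_holds hT 1).mtRank) := by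
  classical
  have hkE : E.dim = k := schemeDim_eq_holds hE
  have hlT : T.dim = l := schemeDim_eq_holds hT
  subst hkE hlT
  haveI := BettiUniverse.finite hX 1
  haveI := BettiUniverse.finite hE 1
  haveI := BettiUniverse.finite hT 1
  by_cases hEcm : IsOfCMType E
  · have h2 : (BettiUniverse.hodge exists_isReal_hodgeModel_holds hE 1).mtRank = 2 := mtRank_hodge_one_eq_two_of_cm_curve hE1 hEcm
    rcases mtRank_hodge_one_of_isSimple_threefold hT hTs hT3 with ⟨h1, h22⟩ | ⟨h2', h10⟩ | ⟨h3, h10⟩ | ⟨h6, hTcm, h4⟩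
    · left
      have h := mtRank_hodge_one_eq_twentythree_of_isIsogenous_cmCurve_prod_threefold_endRankOne hX hE1 hEcm hT3 h1 hXP
      omega
    · by_cases hfor : Nonempty (E.endAlgebra →+* T.endAlgebra)
      · right
        have h := (mtRank_hodge_one_eq_ten_iff_nonempty_ringHom_of_isIsogenous_cmCurve_prod_isSimple_threefold hX hE1 hEcm hTs hT3 h2' hXP).2 hfor
        exact ⟨hEcm, hfor, by omega⟩
      · left
        rw [not_nonempty_iff] at hfor
        have h := (mtRank_hodge_one_eq_eleven_iff_isEmpty_ringHom_of_isIsogenous_cmCurve_prod_isSimple_threefold hX hE1 hEcm hTs hT3 h2' hXP).2 hfor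
        omega
    · left
      have h := mtRank_hodge_one_eq_eleven_of_isIsogenous_cmCurve_prod_isSimple_threefold_of_finrank_eq_three hX hE1 hEcm hTs hT3 h3 hXP
      omega
    · by_cases hfor : Nonempty (E.endAlgebra →+* T.endAlgebra)
      · right
        have h := (mtRank_hodge_one_eq_four_iff_nonempty_ringHom_of_isIsogenous_cmCurve_prod_isSimple_cmThreefold hX hE1 hEcm hTs hT3 hTcm hXP).2 hfor
        exact ⟨hEcm, hfor, by omega⟩
      · left
        rw [not_nonempty_iff] at hfor
        have h := (mtRank_hodge_one_eq_five_iff_isEmpty_ringHom_of_isIsogenous_cmCurve_prod_isSimple_cmThreefold hX hE1 hEcm hTs hT3 hTcm hXP).2 hfor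
        omega
  · left
    have h4 : (BettiUniverse.hodge exists_isReal_hodgeModel_holds hE 1).mtRank = 4 := (curve_facts_of_not_isOfCMType hE1 hEcm).1
    have hTE : ∀ u : T ⟶ E, u = 0 := hom_eq_zero_of_isSimple_of_dim_ne hTs (isSimple_of_dim_le_one hE1.le) (by omega)
    have h := mtRank_hodge_one_eq_add_three_of_isIsogenous_threefold_prod_nonCMCurve hX hT hT3 hE1 hEcm hTE hXP
    omega

/-- **The Mumford–Tate rank of an elliptic curve × a simple abelian threefold is one of `4, 5, 7, 10, 11, 13, 23, 25`** (all eight occur: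
`(t(E), t(T)) ∈ {2, 4} × {4, 10, 22}` with the product formula, and the two case-(a) values `4`, `10`).
[cite: MoonenZarhin1999LowDim, Thm. (0.1), §2 (2.1), (2.3) and §3] -/
theorem mtRank_hodge_one_mem_of_isIsogenous_curve_prod_isSimple_threefold (hX : IsSmoothProjective n X.X) {E T : AbelianVariety ℂ}
    (hE1 : E.dim = 1) (hTs : T.IsSimple) (hT3 : T.dim = 3) (hXP : IsIsogenous X (E.prod T)) :
    haveI := BettiUniverse.finite hX 1
    (BettiUniverse.hodge exists_isReal_hodgeModel_holds hX 1).mtRank ∈ ({4, 5, 7, 10, 11, 13, 23, 25} : Set ℕ) := by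
  classical
  have hE : IsSmoothProjective E.dim E.X := AbelianVariety.isSmoothProjective_holds
  have hT : IsSmoothProjective T.dim T.X := AbelianVariety.isSmoothProjective_holds
  haveI := BettiUniverse.finite hX 1
  haveI := BettiUniverse.finite hE 1
  haveI := BettiUniverse.finite hT 1
  simp only [Set.mem_insert_iff, Set.mem_singleton_iff]
  by_cases hEcm : IsOfCMType E
  · rcases mtRank_hodge_one_of_isSimple_threefold hT hTs hT3 with ⟨h1, -⟩ | ⟨h2', -⟩ | ⟨h3, -⟩ | ⟨-, hTcm, -⟩
    · have h := mtRank_hodge_one_eq_twentythree_of_isIsogenous_cmCurve_prod_threefold_endRankOne hX hE1 hEcm hT3 h1 hXP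
      omega
    · by_cases hfor : Nonempty (E.endAlgebra →+* T.endAlgebra)
      · have h := (mtRank_hodge_one_eq_ten_iff_nonempty_ringHom_of_isIsogenous_cmCurve_prod_isSimple_threefold hX hE1 hEcm hTs hT3 h2' hXP).2 hfor
        omega
      · rw [not_nonempty_iff] at hfor
        have h := (mtRank_hodge_one_eq_eleven_iff_isEmpty_ringHom_of_isIsogenous_cmCurve_prod_isSimple_threefold hX hE1 hEcm hTs hT3 h2' hXP).2 hfor
        omega
    · have h := mtRank_hodge_one_eq_eleven_of_isIsogenous_cmCurve_prod_isSimple_threefold_of_finrank_eq_three hX hE1 hEcm hTs hT3 h3 hXP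
      omega
    · rcases mtRank_hodge_one_mem_of_isIsogenous_cmCurve_prod_isSimple_cmThreefold hX hE1 hEcm hTs hT3 hTcm hXP with h | h <;> omega
  · have hTE : ∀ u : T ⟶ E, u = 0 := hom_eq_zero_of_isSimple_of_dim_ne hTs (isSimple_of_dim_le_one hE1.le) (by omega)
    have h := mtRank_hodge_one_eq_add_three_of_isIsogenous_threefold_prod_nonCMCurve hX hT hT3 hE1 hEcm hTE hXP
    rcases mtRank_hodge_one_mem_of_isSimple_threefold hT hTs hT3 with ht | ht | ht <;> omega

end Summit.HodgeConjecture.CorCM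

end
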